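import Summits.QuantumFields.YangMills.Theorems.BalabanUVNodesN18Beta0LimitOfKernelLetters
import Summits.QuantumFields.YangMills.Theorems.BalabanUVNodesK3V5Defs
import Summits.QuantumFields.YangMills.Theorems.BalabanUVNodesN17AtBetaOfRecord

/-!
# BalabanUVNodes ∕ N18 — THE (2.12) EXISTENCE CLAUSE AND (AF-0r) FROM K3⁷ v5's RATES PREDICATE `PHolderD4` AT ONE TUPLE, NO DISPLAYED CLAUSE:
# `ReadOutAt ∧ N22At` give `Beta0LimitExists` (file 1), `N17At ∧ ρ < 1` give the scale-shift rate, and dag-n17-a's `af0r_beta0OfMerged_of_scaleShiftRate`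
# turns the pair into the geometric convergence of the ONE-LOOP NUMBERS OF RECORD `β⁰_{k+1} → β⁰_∞`
# (Track A, DAG node N18 = NE5, cluster K4 «SpineRates»; key K3⁷ `SpineGivenEndpointR13SepCoPH`, skeleton v5 941dddb108cbaacf, tree names `…K3V5Defs`)

Cell `pub-ymgap` (HUMAN RULING D-0062), WIDTH SEAT `pub-ymgap-dag-n18-w1` generation 3, FILE 2 (sequel of `…N18Beta0LimitOfKernelLetters`).  THEOREMS ONLY (0 `def`,
0 `instance`, 0 `notation`, 0 `sorry`; standard axioms); filed `--kind proof --supports stmt-QuantumFields-20544 --as helper`.  COUNT-NEUTRAL.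

HONEST FRAMING (binding).  A LOCATED by-name junction of THREE landed things: file 1's `beta0LimitExists_βfun_of_readOutAt_n22` ((D4) ∧ N22 ⇒ the clause),
dag-n17-a's `Summit.QuantumFields.YangMills.Theorems.BalabanUVNodesN17.af0r_beta0OfMerged_of_scaleShiftRate` (clause ∧ coherent admissible reference histories ∧
`ScaleShiftRate c ρ γ β_m`, `ρ < 1` ⇒ (AF-0r)), and dag-n27-w1's tree mirror `…K3V5Defs` of K3⁷ v5's predicates (`PHolderD4`, `rrOfRecord`, `KeyedRatesHolderD4`).
`PHolderD4 β D R` ∕ `KeyedRatesHolderD4 β (rrOfRecord 𝔯 ksel)` are STUB 1's conjuncts — HYPOTHESES here, proved NOWHERE (`stub_rates13H` NOT proved; no reading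
`𝔯` is constructed); the reference histories' coherence `hcoh` and admissibility `hadm` are displayed as in every N17 consumer.  Under `ForSmallCouplings` the keyed
edition is exactly as vacuous as `ForSmallCouplings` itself when no bare sequence is tuned (`ForSmallCouplings.of_no_tuned`) — said, not hidden.  Nothing of
Bałaban's is asserted or instantiated; N17 ∕ N18 ∕ N22 NOT discharged; K3⁷ OPEN; counts UNMOVED (typed 28∕28 · discharged 5∕27 (A 5∕28); the chair's single
count line is the only count).  One finite four-torus programme at fixed ε — R4 closes the CONDITIONAL rung `BalabanLadder.UV` only; NOTHING about the continuum
limit, ℝ⁴, OS axioms, infinite volume or the Yang–Mills mass gap (Clay) is proved or claimed by any of this.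

WHY.  dag-n17-w1's `…N17AtRecord13SharedStub` §4 and dag-n17-a's companion 4 produce (AF-0r) — `∃ β⁰_∞, |β⁰_{k+1} − β⁰_∞| ≤ (c∕(1−ρ))·ρ^k` for the one-loop numbers
`beta0OfMerged β_m θ.v₀` of the merged β of record — FROM the N17 body PLUS the DISPLAYED path-limit clause `Beta0LimitExists β_m θ.v₀`.  K3⁷ v5's rates predicate at
a tuple, `PHolderD4 β D R := RatesHolderAt D R β ∧ ReadOutAt D R.u3 ∧ (0 ≤ R.u3.ρ ∧ R.u3.ρ < 1)`, carries `N17At D R.u3` (= `ScaleShiftRate (cr·C₅·θ) ρ γ D.βfun`),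
`N22At R.u3`, `ReadOutAt D R.u3` and `ρ < 1`; by file 1 the (D4) ∧ N22 pair already gives the clause.  So AT ONE TUPLE AND RUN LENGTH OF STUB 1's PREDICATE the
one-loop numbers of the datum's β converge geometrically with NO existence clause displayed — and at the bundle of record `rrOfRecord 𝔯 ksel F θ hP g₀ os` this is
the consumers' (AF-0r) for `beta0OfMerged (betaMerged F (mergedTermFamilyMatT F 2 (TcanOfRecord F 2) (chiβOfRecord₁₃ F 2 θ') θ'.εbg) θ'.ρ8 θ'.bV) θ.v₀` verbatim.

WHAT (theorems only).
* §1 ANY datum and node-U3 carriers: `beta0LimitExists_βfun_of_ratesHolderAt_readOutAt` · ★ `af0r_βfun_of_readOutAt_n17_n22` ((D4) ∧ N17 ∧ N22 ∧ `ρ < 1` ∧ `hcoh` ∧ `hadm`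
  ⇒ (AF-0r) for `beta0OfMerged D.βfun v₀`, constant `u.cr·u.C₅·u.θ ∕ (1 − u.ρ)`).
* §2 K3⁷ v5 names (`…K3V5Defs`): ★ `beta0LimitExists_βfun_of_pHolderD4` · ★★ `af0r_βfun_of_pHolderD4`.
* §3 AT THE BUNDLE OF RECORD `rrOfRecord 𝔯 ksel F θ hP g₀ os` (window radius `θ.γ`, `rfl`; the datum's β IS `betaOfRecord₁₃`, `rfl`, = the merged β on the boxes):
  ★★ `beta0LimitExists_betaMerged_record_of_pHolderD4` (the consumers' `hlim`) · ★★ `af0r_beta0OfMerged_record_of_pHolderD4` (the consumers' (AF-0r) conclusion).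
* §4 UNDER STUB 1's SECOND CONJUNCT `KeyedRatesHolderD4 β (rrOfRecord 𝔯 ksel)`: ★ `forSmallCouplings_beta0LimitExists_af0r_of_keyedRatesHolderD4` — at every guarded
  admissible tuple at which statement (B) and the UV endpoint hold, `ForSmallCouplings D (g₀ ↦ ∀ os, clause ∧ (AF-0r))` (`ForSmallCouplings.mono`).

References (locators only): [I] = [Balaban1987RG1] T. Bałaban, Commun. Math. Phys. **109** (1987): (1.20)–(1.22) p. 264, (2.12)–(2.14) p. 268, §5 p. 298, Thm 2 p. 259.
-/

noncomputable section

open Filter Topology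
open scoped BigOperators

namespace YMDAG.N18.Beta0LimitOfPHolderD4

open Literature.MathematicalPhysics.QuantumFieldTheory.Balaban1983to89
open Literature.MathematicalPhysics.QuantumFieldTheory.Balaban1983to89.T4Continuum (T4Family ULoop)
open Literature.MathematicalPhysics.QuantumFieldTheory.Balaban1983to89.T4ContinuumYM4Torus (ForSmallCouplings)
open Literature.MathematicalPhysics.QuantumFieldTheory.Balaban1983to89.FlowStep (Box HBeta mem_box)
open Literature.MathematicalPhysics.QuantumFieldTheory.Balaban1983to89.T4CouplingMatching (ScaleShiftRate)
open Literature.MathematicalPhysics.QuantumFieldTheory.Balaban1983to89.Node00 (betaMerged betaOfMerged beta0OfMerged Beta0LimitExists betaOfMerged_of_mem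
  mergedTermFamilyMatT TcanOfRecord chiβOfRecord₁₃ betaOfRecord₁₃ Stage13HParams datumOfRecord₁₃CoPH)
open YMDAG.UVSplit (U3Carriers RateCarriers N17At N22At ReadOutAt Datum RateReading₁₃CoPH rateCarriersOfRecord₁₃CoPH)
open Summit.QuantumFields.YangMills.BalabanUVNodes.SpineRatesHolder (RatesHolderAt)
open Summit.QuantumFields.YangMills.Theorems.K3V5Defs (PHolderD4 KeyedRatesHolderD4 rrOfRecord RunSel)
open Summit.QuantumFields.YangMills.Theorems.BalabanUVNodesN17 (af0r_beta0OfMerged_of_scaleShiftRate)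
open YMDAG.N18.Beta0LimitOfKernelLetters (beta0LimitExists_βfun_of_readOutAt_n22 beta0OfMerged_congr_box beta0LimitExists_betaOfMerged_iff)

/-! ## §1 At ANY datum and node-U3 carriers: (D4) ∧ N17 ∧ N22 ∧ `ρ < 1` ⇒ the clause and (AF-0r), nothing else displayed but `hcoh` ∕ `hadm` -/

section Carriers

open scoped Matrix.Norms.L2Operator

variable {N : ℕ} [NeZero N] {F : T4Family}

/-- **THE CLAUSE FROM THE RATES ROW + (D4)**: `RatesHolderAt D R β` (its N22 conjunct) and `ReadOutAt D R.u3` give `Beta0LimitExists D.βfun v₀` at reference histories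
admissible in `]0, R.u3.γ]` (file 1; N14 ∕ N15 ∕ N16 ∕ N17 ∕ N18 idle). [cite: Balaban1987RG1, (2.12)-(2.14) p.268 and §5 p.298] -/
theorem beta0LimitExists_βfun_of_ratesHolderAt_readOutAt (D : Datum F N) {R : RateCarriers N} {β : ℝ} (hR : RatesHolderAt D R β)
    (hD4 : ReadOutAt D R.u3) {v₀ : (k : ℕ) → (Fin (k + 1) → ℝ)} (hadm : ∀ k i, 0 < v₀ k i ∧ v₀ k i ≤ R.u3.γ) : Beta0LimitExists D.βfun v₀ :=
  beta0LimitExists_βfun_of_readOutAt_n22 D hD4 hR.2.2.2.2.2 hadm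

/-- ★ **(AF-0r) FOR THE DATUM's ONE-LOOP NUMBERS FROM (D4) ∧ N17 ∧ N22 ∧ `ρ < 1`** — NO existence clause displayed: `ReadOutAt D u`, `N17At D u`
(= `ScaleShiftRate (u.cr·u.C₅·u.θ) u.ρ u.γ D.βfun`), `N22At u`, `u.ρ < 1`, coherent reference histories admissible in `]0, u.γ]` ⟹
`∃ β⁰_∞, ∀ k, |beta0OfMerged D.βfun v₀ k − β⁰_∞| ≤ (u.cr·u.C₅·u.θ ∕ (1 − u.ρ))·u.ρ^k` (file 1 ∘ dag-n17-a's `af0r_beta0OfMerged_of_scaleShiftRate`).  LOCATED: the three node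
rows are hypotheses. [cite: Balaban1987RG1, (2.12)-(2.14) p.268 and (1.20)-(1.22) p.264] -/
theorem af0r_βfun_of_readOutAt_n17_n22 (D : Datum F N) {u : U3Carriers} (hD4 : ReadOutAt D u) (h17 : N17At D u) (h22 : N22At u) (hρ : u.ρ < 1)
    {v₀ : (k : ℕ) → (Fin (k + 1) → ℝ)} (hcoh : ∀ k, Fin.tail (v₀ (k + 1)) = v₀ k) (hadm : ∀ k i, 0 < v₀ k i ∧ v₀ k i ≤ u.γ) :
    ∃ binf : ℝ, ∀ k, |beta0OfMerged D.βfun v₀ k - binf| ≤ u.cr * u.C₅ * u.θ / (1 - u.ρ) * u.ρ ^ k :=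
  af0r_beta0OfMerged_of_scaleShiftRate (beta0LimitExists_βfun_of_readOutAt_n22 D hD4 h22 hadm) hcoh hadm
    ((hadm 0 0).1.trans_le (hadm 0 0).2) hρ h17

end Carriers

/-! ## §2 In K3⁷ v5's names (`…K3V5Defs`): `PHolderD4 β D R` at ONE tuple carries the clause and (AF-0r) -/

section PHolder

open scoped Matrix.Norms.L2Operator

variable {F : T4Family}

/-- ★ **STUB 1's RATES PREDICATE AT A TUPLE ⇒ THE (2.12) CLAUSE** for the datum's β at reference histories admissible in `]0, R.u3.γ]` (its (D4) and N22 conjuncts;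
file 1).  `PHolderD4` is K3⁷ v5's predicate mirrored in the tree by dag-n27-w1 — a HYPOTHESIS here. [cite: Balaban1987RG1, (2.12)-(2.14) p.268 and §5 p.298] -/
theorem beta0LimitExists_βfun_of_pHolderD4 {β : ℝ} (D : Datum F 2) {R : RateCarriers 2} (h : PHolderD4 β D R)
    {v₀ : (k : ℕ) → (Fin (k + 1) → ℝ)} (hadm : ∀ k i, 0 < v₀ k i ∧ v₀ k i ≤ R.u3.γ) : Beta0LimitExists D.βfun v₀ :=
  beta0LimitExists_βfun_of_ratesHolderAt_readOutAt D h.1 h.2.1 hadm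

/-- ★★ **STUB 1's RATES PREDICATE AT A TUPLE ⇒ (AF-0r) FOR THE DATUM's ONE-LOOP NUMBERS**, no existence clause displayed: its N17 conjunct is the scale-shift
rate, its (D4) ∧ N22 conjuncts give the clause, its letter `R.u3.ρ < 1` is the ratio; `hcoh` ∕ `hadm` displayed. [cite: Balaban1987RG1, (2.12)-(2.14) p.268 and (1.20)-(1.22) p.264] -/
theorem af0r_βfun_of_pHolderD4 {β : ℝ} (D : Datum F 2) {R : RateCarriers 2} (h : PHolderD4 β D R)
    {v₀ : (k : ℕ) → (Fin (k + 1) → ℝ)} (hcoh : ∀ k, Fin.tail (v₀ (k + 1)) = v₀ k) (hadm : ∀ k i, 0 < v₀ k i ∧ v₀ k i ≤ R.u3.γ) :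
    ∃ binf : ℝ, ∀ k, |beta0OfMerged D.βfun v₀ k - binf| ≤ R.u3.cr * R.u3.C₅ * R.u3.θ / (1 - R.u3.ρ) * R.u3.ρ ^ k :=
  af0r_βfun_of_readOutAt_n17_n22 D h.2.1 h.1.2.2.2.1 h.1.2.2.2.2.2 h.2.2.2 hcoh hadm

end PHolder

/-! ## §3 At the bundle of record `rrOfRecord 𝔯 ksel F θ hP g₀ os`: the consumers' `hlim` and (AF-0r) for the MERGED β of record -/

section Record

open scoped Matrix.Norms.L2Operator

variable {F : T4Family}

/-- ★★ **THE CONSUMERS' `hlim` FROM STUB 1's RATES PREDICATE AT THE BUNDLE OF RECORD** (one tuple `(F, θ, hP, g₀, os)`, the selected run length): the window radius of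
`(rrOfRecord 𝔯 ksel F θ hP g₀ os).u3` IS `θ.γ` and the datum's β IS `betaOfRecord₁₃ F 2 θ` (both `rfl`), which is the merged β on the boxes (file 1 §2) — so
`PHolderD4 β (datumOfRecord₁₃CoPH F 2 θ hP) (rrOfRecord 𝔯 ksel F θ hP g₀ os)` and admissible `θ.v₀` give
`Beta0LimitExists (betaMerged F (mergedTermFamilyMatT F 2 (TcanOfRecord F 2) (chiβOfRecord₁₃ F 2 θ') θ'.εbg) θ'.ρ8 θ'.bV) θ.v₀`, `θ' := θ.toStage13Params` — VERBATIM
the `hlim` of the N17 ∕ N13 ∕ N28 consumers.  LOCATED: `PHolderD4` is a hypothesis; no `𝔯` is constructed. [cite: Balaban1987RG1, (2.12)-(2.14) p.268 and §5 p.298] -/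
theorem beta0LimitExists_betaMerged_record_of_pHolderD4 {β : ℝ} (𝔯 : RateReading₁₃CoPH 2) (ksel : RunSel) (θ : Stage13HParams F 2)
    (hP : θ.Provisos₁₃CoPH F 2) (g₀ : ℕ → ℝ) (os : List (ULoop F))
    (h : PHolderD4 β (datumOfRecord₁₃CoPH F 2 θ hP) (rrOfRecord 𝔯 ksel F θ hP g₀ os)) (hadm : ∀ k i, 0 < θ.v₀ k i ∧ θ.v₀ k i ≤ θ.γ) :
    letI := θ.instVβ₁; letI := θ.instVβ₂; letI := θ.instιβ
    Beta0LimitExists (betaMerged F (mergedTermFamilyMatT F 2 (TcanOfRecord F 2) (chiβOfRecord₁₃ F 2 θ.toStage13Params) θ.εbg) θ.ρ8 θ.bV) θ.v₀ := by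
  letI := θ.instVβ₁; letI := θ.instVβ₂; letI := θ.instιβ
  have hlim := beta0LimitExists_βfun_of_pHolderD4 (datumOfRecord₁₃CoPH F 2 θ hP) h (v₀ := θ.v₀) hadm
  exact (beta0LimitExists_betaOfMerged_iff _ _ hadm).1 hlim

/-- ★★ **THE CONSUMERS' (AF-0r) FROM STUB 1's RATES PREDICATE AT THE BUNDLE OF RECORD**, no existence clause displayed: with coherent admissible `θ.v₀`,
`∃ β⁰_∞, ∀ k, |beta0OfMerged β_m θ.v₀ k − β⁰_∞| ≤ (cr·C₅·θ₅ ∕ (1 − ρ))·ρ^k` for the merged β of record `β_m`, the letters being those of the bundle's node-U3 component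
(under K3⁷ v5's pin `U3PinnedKernels 𝔯 ℓ` they are `(ℓ F θ).cr ∕ .C₅ ∕ .θ₅ ∕ .ρ`).  The one-loop numbers of `betaOfRecord₁₃` and of `β_m` agree (file 1 §2, `beta0OfMerged_congr_box`).
LOCATED. [cite: Balaban1987RG1, (2.12)-(2.14) p.268 and (1.20)-(1.22) p.264] -/
theorem af0r_beta0OfMerged_record_of_pHolderD4 {β : ℝ} (𝔯 : RateReading₁₃CoPH 2) (ksel : RunSel) (θ : Stage13HParams F 2)
    (hP : θ.Provisos₁₃CoPH F 2) (g₀ : ℕ → ℝ) (os : List (ULoop F))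
    (h : PHolderD4 β (datumOfRecord₁₃CoPH F 2 θ hP) (rrOfRecord 𝔯 ksel F θ hP g₀ os))
    (hcoh : ∀ k, Fin.tail (θ.v₀ (k + 1)) = θ.v₀ k) (hadm : ∀ k i, 0 < θ.v₀ k i ∧ θ.v₀ k i ≤ θ.γ) :
    letI := θ.instVβ₁; letI := θ.instVβ₂; letI := θ.instιβ
    ∃ binf : ℝ, ∀ k,
      |beta0OfMerged (betaMerged F (mergedTermFamilyMatT F 2 (TcanOfRecord F 2) (chiβOfRecord₁₃ F 2 θ.toStage13Params) θ.εbg) θ.ρ8 θ.bV) θ.v₀ k - binf| ≤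
        (rrOfRecord 𝔯 ksel F θ hP g₀ os).u3.cr * (rrOfRecord 𝔯 ksel F θ hP g₀ os).u3.C₅ * (rrOfRecord 𝔯 ksel F θ hP g₀ os).u3.θ /
            (1 - (rrOfRecord 𝔯 ksel F θ hP g₀ os).u3.ρ) * (rrOfRecord 𝔯 ksel F θ hP g₀ os).u3.ρ ^ k := by
  letI := θ.instVβ₁; letI := θ.instVβ₂; letI := θ.instιβ
  obtain ⟨binf, hb⟩ := af0r_βfun_of_pHolderD4 (datumOfRecord₁₃CoPH F 2 θ hP) h (v₀ := θ.v₀) hcoh hadm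
  refine ⟨binf, fun k => ?_⟩
  have hcongr : beta0OfMerged (datumOfRecord₁₃CoPH F 2 θ hP).βfun θ.v₀ k =
      beta0OfMerged (betaMerged F (mergedTermFamilyMatT F 2 (TcanOfRecord F 2) (chiβOfRecord₁₃ F 2 θ.toStage13Params) θ.εbg) θ.ρ8 θ.bV) θ.v₀ k :=
    beta0OfMerged_congr_box (γ := θ.γ) (fun _ _ hv => betaOfMerged_of_mem _ _ _ hv) hadm k
  rw [← hcongr]
  exact hb k

end Record

/-! ## §4 Under stub 1's second conjunct `KeyedRatesHolderD4 β (rrOfRecord 𝔯 ksel)`: the clause and (AF-0r) on the tuned window of every guarded admissible tuple -/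

section Keyed

open scoped Matrix.Norms.L2Operator

variable {F : T4Family}

/-- ★ **STUB 1's SECOND CONJUNCT ⇒ THE CLAUSE AND (AF-0r) ON THE TUNED WINDOW** at every Stage-13 tuple with core provisos, `ZhUnity ∧ SlotsNondegenerate₁₃`,
`Admissible`, statement (B) and the UV endpoint, for coherent admissible `θ.v₀`: `ForSmallCouplings D (g₀ ↦ ∀ os, hlim ∧ (AF-0r) at (rrOfRecord 𝔯 ksel F θ hP g₀ os).u3's
letters)` (`ForSmallCouplings.mono` over §3).  HONEST: as vacuous as `ForSmallCouplings` itself when no bare sequence is tuned (`ForSmallCouplings.of_no_tuned`);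
`KeyedRatesHolderD4` is stub 1's conjunct, a HYPOTHESIS — `stub_rates13H` NOT proved. [cite: Balaban1987RG1, Thm 2 p.259 and (2.12)-(2.14) p.268] -/
theorem forSmallCouplings_beta0LimitExists_af0r_of_keyedRatesHolderD4 {β : ℝ} (𝔯 : RateReading₁₃CoPH 2) (ksel : RunSel)
    (hK : KeyedRatesHolderD4 β (rrOfRecord 𝔯 ksel)) (θ : Stage13HParams F 2) (hP : θ.Provisos₁₃CoPH F 2)
    (hG : θ.ZhUnity F 2 ∧ θ.SlotsNondegenerate₁₃ F 2) (hA : θ.Admissible F 2)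
    (hB : B16.EndStatementBPrinted (datumOfRecord₁₃CoPH F 2 θ hP).C) (hE : DagBinding.EndpointExistence (datumOfRecord₁₃CoPH F 2 θ hP).C.toB12)
    (hcoh : ∀ k, Fin.tail (θ.v₀ (k + 1)) = θ.v₀ k) (hadm : ∀ k i, 0 < θ.v₀ k i ∧ θ.v₀ k i ≤ θ.γ) :
    letI := θ.instVβ₁; letI := θ.instVβ₂; letI := θ.instιβ
    ForSmallCouplings (datumOfRecord₁₃CoPH F 2 θ hP) fun g₀ => ∀ os : List (ULoop F),
      Beta0LimitExists (betaMerged F (mergedTermFamilyMatT F 2 (TcanOfRecord F 2) (chiβOfRecord₁₃ F 2 θ.toStage13Params) θ.εbg) θ.ρ8 θ.bV) θ.v₀ ∧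
        ∃ binf : ℝ, ∀ k,
          |beta0OfMerged (betaMerged F (mergedTermFamilyMatT F 2 (TcanOfRecord F 2) (chiβOfRecord₁₃ F 2 θ.toStage13Params) θ.εbg) θ.ρ8 θ.bV) θ.v₀ k - binf| ≤
            (rrOfRecord 𝔯 ksel F θ hP g₀ os).u3.cr * (rrOfRecord 𝔯 ksel F θ hP g₀ os).u3.C₅ * (rrOfRecord 𝔯 ksel F θ hP g₀ os).u3.θ /
                (1 - (rrOfRecord 𝔯 ksel F θ hP g₀ os).u3.ρ) * (rrOfRecord 𝔯 ksel F θ hP g₀ os).u3.ρ ^ k := by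
  letI := θ.instVβ₁; letI := θ.instVβ₂; letI := θ.instιβ
  refine ForSmallCouplings.mono (fun g₀ hg os => ⟨?_, ?_⟩) (hK F θ hP hG hA hB hE)
  · exact beta0LimitExists_betaMerged_record_of_pHolderD4 𝔯 ksel θ hP g₀ os (hg os) hadm
  · exact af0r_beta0OfMerged_record_of_pHolderD4 𝔯 ksel θ hP g₀ os (hg os) hcoh hadm

end Keyed

end YMDAG.N18.Beta0LimitOfPHolderD4

end
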